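import Summits.HodgeConjecture.HodgeConjecture.Theorems.F0P3cStCharTSSocketsOut   -- ★ (LH6-p02 g4) p850909 «SOCKETS-OUT★»: `isEllipticRep_of_innerG_ne_zero`, `ldsElliptic_of_prop1261c`; brings ★ «ELL-LIN» p848270∕p848283 (`innerG_congr_right`, `innerG_smul_right`), the ★ TR carpets `Ch12Sec5Inputs` ((LDSU) `LdsEllipticPartner`, (LDS2) `LdsCardTwo`, (C2) `EllCartanAE`) ∕ `Ch12Sec6` (`Prop1261b`, `Prop1261c`, `LdsCharactersOpposite`) ∕ `Ch12Sec5Defs`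
import HarnessLib

/-!
# F0 · P3c · line LH6 «StCharTS» — brick «LDSU-OUT★» for the (S-𝔇) package `stub_EllipticPackage`:
# THE SOCKET (LDSU) `LdsEllipticPartner` («the only elliptic partner of an l.d.s. member is its packet-mate») DERIVED FROM THE PACKAGE'S OTHER CONJUNCTS

Cell `hodgecm-mathlib`, crux `H413` (`stmt-HodgeConjecture-24833`), line LH6 `Cruxes/H413/Lines/F0_P3c_StCharTSPaydown.lean` (organ (S-𝔇) `stub_EllipticPackage`: an
existential over a §12.5 datum `𝔇 : Ch12Sec5.EllipticData (U(Φ₃)(L⁺_v)) (H_v)`; among its conjuncts the SOCKETS of ★ `Ch12Sec5Inputs` — printed inputs no carpet states).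
Seat LH6-p04 (g5); THEOREMS ONLY (no `def`, no named fact, no `instance`, no notation, no `sorry`; axioms ⊆ {propext, Classical.choice, Quot.sound});
`--supports stmt-HodgeConjecture-24833`.  Sequel to ★ «SOCKETS-OUT★» (p850909: (LDSE), (DENS), the `G`-half of (DEF), the `H^e` clause of (M1H)).
HONEST LABEL: HC_CM is proved only modulo the 7 printed citations (2 remaining: hLiu418 = stmt-HodgeConjecture-24832, h413 = stmt-HodgeConjecture-24833) until rung 0
closes; this file is count-neutral — it lets a later leaf edition DELETE the socket (LDSU) ★ `EllipticData.LdsEllipticPartner` (ED. 12 :253; consumed only by the (S-a)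
call's binder `hLdsU` → ★ `F0P3cStCharTSSaL2.ldsCoeff_eq`), feeding that binder BY NAME from conjuncts the package keeps.

THE MATHEMATICS (elementary; every numbered statement of print enters only as the ★ carpet RELATION it is consumed from; generic carriers `G`, `H`).
Let `Π ∈ ldsPackets` be an l.d.s. `L`-packet [§12.2 (3) p. 174], `π′ ∈ Π`, `π ∉ Π`, and suppose `{π, π′}` were one of the three kinds of PROPOSITION 12.6.1 (b) (★
`IsEllipticPair π π′`).  Then `π ≠ π′` and Prop. 12.6.1 (c) [p. 188] (★ `Prop1261c`, typed for EVERY pair of distinct classes of one of the three kinds) gives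
`⟨χ_π, χ_{π′}⟩_e = −1`.  By (LDS2) ★ `LdsCardTwo` [p. 174 «`Card(Π) = 2`»] `π′` has a packet-mate `π″ ∈ Π`, `π″ ≠ π′`, and «`χ_{π′} = −χ_{π″}` on `G^e`» [p. 188] (★
`LdsCharactersOpposite`); since the elliptic inner product `⟨ , ⟩_{G,e}` [§12.5 p. 184] integrates over the elliptic Cartan representatives, on which `dγ`-a.e. point is in
`G^e` ((C2) ★ `EllCartanAE`), `⟨χ_π, χ_{π′}⟩_e = −⟨χ_π, χ_{π″}⟩_e` (★ «ELL-LIN» a.e.-congruence and conjugate-homogeneity in the second slot), so `⟨χ_π, χ_{π″}⟩_e = +1 ≠ 0`.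
Now `π` is elliptic (a class whose character pairs non-trivially with something does not vanish on `G^e`: ★ «SOCKETS-OUT★» `isEllipticRep_of_innerG_ne_zero`), `π″` is
elliptic (★ `ldsElliptic_of_prop1261c` = (LDSE) derived, p. 187 «All representations of this type are in fact elliptic»), and `π ≠ π″` (`π ∉ Π ∋ π″`); so Prop. 12.6.1 (b)
[p. 188] (★ `Prop1261b`) makes `{π, π″}` one of the three kinds and Prop. 12.6.1 (c) gives `⟨χ_π, χ_{π″}⟩_e = −1` — contradicting `+1`.  Hence
**(LDSU) ⟸ Prop. 12.6.1 (b) ∧ Prop. 12.6.1 (c) ∧ «`χ_{π¹} = −χ_{π²}` on `G^e`» ∧ (LDS2) ∧ (C2)**: `ldsEllipticPartner_of_prop1261bc`.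
WHY IT PAYS (datum-construction programme): proving (LDSU) at a concrete datum would need the §12.2 label bookkeeping «an l.d.s. member is none of `St_G(ψ)`, `ψ∘det_G`,
`π²(ξ)`, `πⁿ(ξ)` and lies in no second l.d.s. packet» ([Ky], [BZ]); this brick trades it for Prop. 12.6.1 (b)(c), which the package owes anyway.

LEAF EFFECT (for the integrator, a later ED. of `Cruxes/H413/Lines/F0_P3c_StCharTSPaydown.lean`): delete the conjunct `𝔇.LdsEllipticPartner ∧`, drop `hLdsU` from the three
`obtain` patterns, and at the (S-a) call feed `(F0P3cStCharTSLdsuOut.ldsEllipticPartner_of_prop1261bc 𝔇 h61b h61c hLO hLds2 hTell)` in the `hLdsU` slot (every argument an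
existing binder: `h61b`∕`h61c` = Prop. 12.6.1 (b)∕(c), `hLO` = ★ `LdsCharactersOpposite`, `hLds2` = (LDS2), `hTell` = (C2)).

## References
* [Rogawski1990] J. D. Rogawski, *Automorphic Representations of Unitary Groups in Three Variables*, Ann. of Math. Stud. 123 (1990): §12.2 (3) pp. 173–174 (the l.d.s.
  `L`-packets `Π(θ)`, `Card(Π) = 2`); §12.5 p. 184 (`⟨ , ⟩_{G,e}`, `G^e`); §12.6 p. 187 («elliptic representation»), Prop. 12.6.1 (b)(c) p. 188, p. 188 «`χ_{π¹} = −χ_{π²}` on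
  `G^e`»; §12.7 Lemma 12.7.2 (proof) p. 192 (where (LDSU) is used: «the members of `X` outside `Π` pair to zero with `χ_{π′}`»).
-/

set_option autoImplicit false
-- the mandated namespace has the single-problem summit's repeated segment (`HodgeConjecture.HodgeConjecture`)
set_option linter.dupNamespace false

noncomputable section

open MeasureTheory Filter Topology
open Literature.NumberTheory.Automorphic Literature.NumberTheory.Rogawski1990

namespace Summit.HodgeConjecture.HodgeConjecture.Cruxes.H413.F0P3cStCharTSLdsuOut

variable {G H : Type} [Group G] [TopologicalSpace G] [IsTopologicalGroup G] [MeasurableSpace G]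
  [∀ γ : G, MeasurableSpace (G ⧸ Subgroup.centralizer ({γ} : Set G))] [MeasurableSpace (G ⧸ Subgroup.center G)]
  [Group H] [TopologicalSpace H] [IsTopologicalGroup H] [MeasurableSpace H]
  (𝔇 : Ch12Sec5.EllipticData G H)

/-! ## §1 `⟨ , ⟩_{G,e}` against two class functions opposite on `G^e` -/

/-- **`⟨β, α⟩_{G,e} = −⟨β, α′⟩_{G,e}` when `α = −α′` on `G^e`**, under (C2) ★ `EllCartanAE` (the elliptic Cartan representatives lie `dγ`-a.e. in `G^e`): the elliptic
inner product [§12.5 p. 184] only sees values a.e. on those tori (★ «ELL-LIN» `innerG_congr_right`) and is conjugate-homogeneous in the second slot (★ `innerG_smul_right`,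
unconditional). [cite: Rogawski1990, §12.5 p. 184] -/
theorem innerG_eq_neg_of_eq_neg_on_ellG (hC2 : 𝔇.EllCartanAE) (β : G → ℂ) {α α' : G → ℂ}
    (h : ∀ γ ∈ 𝔇.ellG, α γ = -α' γ) :
    𝔇.innerG β α = -𝔇.innerG β α' := by
  have hae : ∀ T ∈ 𝔇.cartanG, ∀ᵐ t : ↥T ∂(𝔇.μT T), α (t : G) = ((-1 : ℂ) • α') (t : G) := fun T hT =>
    (hC2 T hT).mono fun t ht => by rw [Pi.smul_apply, smul_eq_mul, neg_one_mul]; exact h _ ht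
  rw [F0P3cStCharTSEllLin.innerG_congr_right 𝔇 β hae, F0P3cStCharTSEllLin.innerG_smul_right 𝔇 (-1) β α',
    map_neg, map_one, neg_one_mul]

/-- **The two members of an l.d.s. `L`-packet pair oppositely with every class**: for `Π ∈ ldsPackets`, `π′, π″ ∈ Π` distinct and any `π ∈ E(G)`,
`⟨χ_π, χ_{π′}⟩_e = −⟨χ_π, χ_{π″}⟩_e` — from «`χ_{π¹} = −χ_{π²}` on `G^e`» [p. 188] (★ `Ch12Sec6.LdsCharactersOpposite`) and (C2).
[cite: Rogawski1990, §12.6 p. 188; §12.5 p. 184] -/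
theorem innerG_char_eq_neg_of_ldsMates (hLO : Ch12Sec6.LdsCharactersOpposite 𝔇) (hC2 : 𝔇.EllCartanAE)
    {P : Finset (IrrClass G)} (hP : P ∈ 𝔇.ldsPackets) {π' π'' : IrrClass G} (hπ' : π' ∈ P) (hπ'' : π'' ∈ P) (hne : π' ≠ π'')
    (π : IrrClass G) :
    𝔇.innerG (𝔇.char π) (𝔇.char π') = -𝔇.innerG (𝔇.char π) (𝔇.char π'') :=
  innerG_eq_neg_of_eq_neg_on_ellG 𝔇 hC2 (𝔇.char π) (hLO P hP π' hπ' π'' hπ'' hne)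

/-! ## §2 (LDSU) derived -/

/-- **No class outside an l.d.s. packet `Π = {π′, π″}` forms a pair of one of the three kinds with `π′`** — the argument of the module docstring with the mate `π″` given
explicitly: Prop. 12.6.1 (c) at `{π, π′}` gives `−1`, the opposite characters turn it into `⟨χ_π, χ_{π″}⟩_e = +1`, both `π` and `π″` are then elliptic, Prop. 12.6.1 (b)
makes `{π, π″}` a pair of one of the three kinds and Prop. 12.6.1 (c) gives `−1 = +1`.  Hypotheses: ★ `Prop1261b`, ★ `Prop1261c`, ★ `LdsCharactersOpposite`, (LDS2) ★
`LdsCardTwo` (only to know the members of `Π` are elliptic, via ★ `ldsElliptic_of_prop1261c`), (C2) ★ `EllCartanAE`.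
[cite: Rogawski1990, §12.6 Prop. 12.6.1 (b)(c) p. 188; p. 187; §12.2 (3) p. 174; §12.5 p. 184] -/
theorem not_isEllipticPair_of_not_mem_lds (h61b : Ch12Sec6.Prop1261b 𝔇) (h61c : Ch12Sec6.Prop1261c 𝔇)
    (hLO : Ch12Sec6.LdsCharactersOpposite 𝔇) (hLds2 : 𝔇.LdsCardTwo) (hC2 : 𝔇.EllCartanAE)
    {P : Finset (IrrClass G)} (hP : P ∈ 𝔇.ldsPackets) {π' π'' : IrrClass G} (hπ' : π' ∈ P) (hπ'' : π'' ∈ P) (hne' : π' ≠ π'')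
    {π : IrrClass G} (hπ : π ∉ P) :
    ¬ 𝔇.IsEllipticPair π π' := by
  intro hpair
  -- `π ≠ π′` and `π ≠ π″` since `π ∉ Π`
  have hne : π ≠ π' := fun h => hπ (h ▸ hπ')
  have hne'' : π ≠ π'' := fun h => hπ (h ▸ hπ'')
  -- Prop. 12.6.1 (c) at `{π, π′}`: `⟨χ_π, χ_{π′}⟩_e = −1`, hence `⟨χ_π, χ_{π″}⟩_e = +1`
  have hc : 𝔇.innerG (𝔇.char π) (𝔇.char π') = -1 := h61c π π' hne hpair
  have h1 : 𝔇.innerG (𝔇.char π) (𝔇.char π'') = 1 := by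
    have h := innerG_char_eq_neg_of_ldsMates 𝔇 hLO hC2 hP hπ' hπ'' hne' π
    rw [hc] at h
    exact neg_inj.mp h.symm
  have h1ne : 𝔇.innerG (𝔇.char π) (𝔇.char π'') ≠ 0 := by rw [h1]; exact one_ne_zero
  -- both `π` and `π″` are elliptic
  have hell : 𝔇.IsEllipticRep π := F0P3cStCharTSSocketsOut.isEllipticRep_of_innerG_ne_zero 𝔇 hC2 (𝔇.char π'') h1ne
  have hell'' : 𝔇.IsEllipticRep π'' := F0P3cStCharTSSocketsOut.ldsElliptic_of_prop1261c 𝔇 h61c hLds2 hC2 P hP π'' hπ''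
  -- Prop. 12.6.1 (b): `{π, π″}` is a pair of one of the three kinds; Prop. 12.6.1 (c): `⟨χ_π, χ_{π″}⟩_e = −1`, absurd
  have hc'' : 𝔇.innerG (𝔇.char π) (𝔇.char π'') = -1 := h61c π π'' hne'' (h61b π π'' hell hell'' h1ne hne'')
  rw [h1] at hc''
  norm_num at hc''

/-- **(LDSU) ★ `EllipticData.LdsEllipticPartner` DERIVED: the only elliptic partner of an l.d.s. member is its packet-mate** — for every l.d.s. packet `Π`, every
`π′ ∈ Π` and every `π ∉ Π`, `{π, π′}` is not one of the three kinds of Prop. 12.6.1 (b) — from ★ `Ch12Sec6.Prop1261b`, ★ `Prop1261c` [Prop. 12.6.1 (b)(c) p. 188], ★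
`LdsCharactersOpposite` [p. 188], (LDS2) ★ `LdsCardTwo` [§12.2 (3) p. 174] and (C2) ★ `EllCartanAE` [§12.5 p. 184].  At the leaf's (S-a) call the binder `hLdsU` becomes
`ldsEllipticPartner_of_prop1261bc 𝔇 h61b h61c hLO hLds2 hTell`. [cite: Rogawski1990, §12.6 Prop. 12.6.1 (b)(c) p. 188; §12.2 (3) p. 174; §12.7 Lemma 12.7.2 (proof) p. 192] -/
theorem ldsEllipticPartner_of_prop1261bc (h61b : Ch12Sec6.Prop1261b 𝔇) (h61c : Ch12Sec6.Prop1261c 𝔇)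
    (hLO : Ch12Sec6.LdsCharactersOpposite 𝔇) (hLds2 : 𝔇.LdsCardTwo) (hC2 : 𝔇.EllCartanAE) :
    𝔇.LdsEllipticPartner := by
  intro P hP π' hπ' π hπ
  obtain ⟨π'', hπ'', hne', -⟩ := hLds2 P hP π' hπ'
  exact not_isEllipticPair_of_not_mem_lds 𝔇 h61b h61c hLO hLds2 hC2 hP hπ' hπ'' hne'.symm hπ

/-- **Symmetric form**: likewise `{π′, π}` (the pair read in the other order) is not one of the three kinds (★ «Sa-REGROUP KINDS» `isEllipticPair_symm`).
[cite: Rogawski1990, §12.6 Prop. 12.6.1 (b)(c) p. 188; §12.2 (3) p. 174] -/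
theorem not_isEllipticPair_symm_of_not_mem_lds (h61b : Ch12Sec6.Prop1261b 𝔇) (h61c : Ch12Sec6.Prop1261c 𝔇)
    (hLO : Ch12Sec6.LdsCharactersOpposite 𝔇) (hLds2 : 𝔇.LdsCardTwo) (hC2 : 𝔇.EllCartanAE)
    {P : Finset (IrrClass G)} (hP : P ∈ 𝔇.ldsPackets) {π' : IrrClass G} (hπ' : π' ∈ P) {π : IrrClass G} (hπ : π ∉ P) :
    ¬ 𝔇.IsEllipticPair π' π := fun h =>
  ldsEllipticPartner_of_prop1261bc 𝔇 h61b h61c hLO hLds2 hC2 P hP π' hπ' π hπ (F0P3cStCharTSSaRegroupKinds.isEllipticPair_symm 𝔇 h)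

end Summit.HodgeConjecture.HodgeConjecture.Cruxes.H413.F0P3cStCharTSLdsuOut

end
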